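import Mathlib
import HarnessLib
import Summits.NavierStokesRegularity.NavierStokesRegularity.Theorems.UnthreadedDoorAntidynamoWallHeadLaw

/-!
# Route `UnthreadedDoor` / `ThreadingFlux`, crux `PoloidalLiouville` (stmt-NavierStokesRegularity-1222), antidynamo v2 skeleton
# (sha16 `4ebf5683127b`), WALL `stub_scalarLiouville`: consequences of the HEAD LAW at vorticity zeros and near the centre

Support file (seat leafhand-ns-unthreadeddoor-3 g0, cell decomp-ns), `--supports stmt-NavierStokesRegularity-1222 --as helper`; theorems only;
sequel of `UnthreadedDoorAntidynamoWallHeadLaw` (p823684: `∇χ = (𝓛T)·y − (m + 2)·∇T` on `ℝ³ ∖ {x₀}`, `y = x − x₀`, `m = ⟪v, y⟫`,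
`𝓛T = ∂ₜT + ⟪v,∇T⟫ − ΔT`).

* `HeadLaw.normSq_mul_inner_sub` — `‖y‖²⟪v,a⟫ − ⟪v,y⟫⟪a,y⟫ = −⟪v, (a × y) × y⟫`: the tangential-transport bracket of the head law is a
  function of `a × y` alone, so it VANISHES AT SPHERE-CRITICAL POINTS of the potential (`∇T × y = 0`), i.e. — under the representation
  `curl v = ∇T × y` — exactly at the ZEROS OF THE VORTICITY off the centre.
* ★ `HeadLaw.envelope_identity` — at such a point `r²·(∂ₜT − ΔT) = 2⟪∇T, y⟫ + ⟪∇χ, y⟫` (`r = ‖y‖`): the ENVELOPE IDENTITY of the net-flux line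
  (NF-1, `NetFlux.NetFluxSubsolution`: «envelope identity at the spherical extrema») in global-head form — no monotone arc, no saddle-free sphere is
  needed to STATE it, because the head `χ` is a global function (p823684); `HeadLaw.envelope_identity_of_curl_eq_zero` is the same at a vorticity zero.
* `HeadLaw.cross_gradient_head_eq_zero_iff` — where `m + 2 ≠ 0` the sphere-critical sets of the head and of the potential COINCIDE; and
  `HeadLaw.two_add_inner_pos` — `m + 2 > 0` on the ball `‖x − x₀‖ < 2/C` for `‖v(t,x)‖ ≤ C`: NEAR THE CENTRE the head is anti-aligned with the
  potential on every sphere (`∇_Sχ = −(m+2)∇_S T` with a positive weight), `HeadLaw.sphCrit_head_iff_near_centre`.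

HONEST LABEL: pointwise calculus on the head law; nothing here proves `stub_scalarLiouville`, `PoloidalLiouville` (1222) or bears on Navier–Stokes
regularity; no summit statement is proved. [folklore] [cite: MajdaBertozziCUP2002, §1.1 (vector identities); KochNadirashviliSereginSverak2009,
(5.4) (arXiv:0709.3599 p. 9)]
-/

noncomputable section

-- the summit and its single sub-problem share the name (CONVENTIONS §1)
set_option linter.dupNamespace false

open Set Function Filter Topology InnerProductSpace
open scoped RealInnerProductSpace ContDiff

namespace Summit.NavierStokesRegularity.NavierStokesRegularity.Theorems.PoloidalLiouville.Antidynamo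

open Literature.Analysis Literature.Analysis.FluidPDE
open Summit.NavierStokesRegularity.NavierStokesRegularity.Theorems.PoloidalLiouville.NetFlux (E3)

namespace HeadLaw

/-! ### §1 The tangential-transport bracket is a function of `a × y` -/

/-- **`‖y‖²⟪v, a⟫ − ⟪v, y⟫⟪a, y⟫ = −⟪v, (a × y) × y⟫`** (BAC–CAB: `(a × y) × y = ⟪a, y⟫y − ‖y‖²a`). [cite: MajdaBertozziCUP2002, §1.1 (vector identities)] -/
theorem normSq_mul_inner_sub (v a y : E3) :
    ‖y‖ ^ 2 * ⟪v, a⟫ - ⟪v, y⟫ * ⟪a, y⟫ = -⟪v, cross (cross a y) y⟫ := by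
  simp [cross, crossProduct, PiLp.inner_apply, Fin.sum_univ_three, EuclideanSpace.norm_sq_eq]
  ring

/-- At a sphere-critical point of `a` (`a × y = 0`) the bracket vanishes: `‖y‖²⟪v, a⟫ = ⟪v, y⟫⟪a, y⟫`. [folklore] -/
theorem normSq_mul_inner_eq_of_cross_eq_zero {v a y : E3} (h : cross a y = 0) :
    ‖y‖ ^ 2 * ⟪v, a⟫ - ⟪v, y⟫ * ⟪a, y⟫ = 0 := by
  rw [normSq_mul_inner_sub, h]
  have h0 : cross (0 : E3) y = 0 := by
    ext i
    fin_cases i <;> simp [cross, crossProduct]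
  rw [h0, inner_zero_right, neg_zero]

variable {v : ℝ → E3 → E3} {x₀ : E3} {T : ℝ → E3 → ℝ} {χ : E3 → ℝ} {t : ℝ}

/-! ### §2 ★ The envelope identity at sphere-critical points / vorticity zeros -/

/-- ★ **ENVELOPE IDENTITY (global-head form).**  Under the head law, at every sphere-critical point `x ≠ x₀` of the potential slice
(`∇T(t,x) × (x − x₀) = 0` — in particular at every spherical maximum or minimum of `T(t,·)`):
`‖x − x₀‖²·(∂ₜT − ΔT)(t,x) = 2⟪∇T(t,x), x − x₀⟫ + ⟪∇χ(x), x − x₀⟫` — the tangential transport drops out.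
[cite: KochNadirashviliSereginSverak2009, (5.4) (arXiv:0709.3599 p. 9)] -/
theorem envelope_identity
    (hχ : ∀ x, x ≠ x₀ → gradient χ x =
      (deriv (fun s => T s x) t + ⟪v t x, gradient (T t) x⟫ - Laplacian.laplacian (T t) x) • (x - x₀)
        - (⟪v t x, x - x₀⟫ + 2) • gradient (T t) x)
    {x : E3} (hx : x ≠ x₀) (hcrit : cross (gradient (T t) x) (x - x₀) = 0) :
    ‖x - x₀‖ ^ 2 * (deriv (fun s => T s x) t - Laplacian.laplacian (T t) x) =
      2 * ⟪gradient (T t) x, x - x₀⟫ + ⟪gradient χ x, x - x₀⟫ := by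
  have h := tangentialTransport_head hχ hx
  have h0 := normSq_mul_inner_eq_of_cross_eq_zero (v := v t x) hcrit
  linear_combination h - h0

/-- **The same at a ZERO OF THE VORTICITY** off the centre, under the representation `curl v(t) = ∇T(t) × (x − x₀)`: the heat defect of the
potential at a vorticity zero is radial, `‖x − x₀‖²·(∂ₜT − ΔT) = 2⟪∇T, x − x₀⟫ + ⟪∇χ, x − x₀⟫`. [folklore] -/
theorem envelope_identity_of_curl_eq_zero
    (hrep : ∀ x, curl (v t) x = cross (gradient (T t) x) (x - x₀))
    (hχ : ∀ x, x ≠ x₀ → gradient χ x =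
      (deriv (fun s => T s x) t + ⟪v t x, gradient (T t) x⟫ - Laplacian.laplacian (T t) x) • (x - x₀)
        - (⟪v t x, x - x₀⟫ + 2) • gradient (T t) x)
    {x : E3} (hx : x ≠ x₀) (hω : curl (v t) x = 0) :
    ‖x - x₀‖ ^ 2 * (deriv (fun s => T s x) t - Laplacian.laplacian (T t) x) =
      2 * ⟪gradient (T t) x, x - x₀⟫ + ⟪gradient χ x, x - x₀⟫ :=
  envelope_identity hχ hx (by rw [← hrep x, hω])

/-! ### §3 Near the centre the head is anti-aligned with the potential -/

/-- **Where `m + 2 ≠ 0` the sphere-critical sets of the head and of the potential coincide**: `∇χ × y = 0 ↔ ∇T × y = 0`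
(`∇χ × y = −(m + 2)·(∇T × y)`). [folklore] -/
theorem cross_gradient_head_eq_zero_iff
    (hχ : ∀ x, x ≠ x₀ → gradient χ x =
      (deriv (fun s => T s x) t + ⟪v t x, gradient (T t) x⟫ - Laplacian.laplacian (T t) x) • (x - x₀)
        - (⟪v t x, x - x₀⟫ + 2) • gradient (T t) x)
    {x : E3} (hx : x ≠ x₀) (hm : ⟪v t x, x - x₀⟫ + 2 ≠ 0) :
    cross (gradient χ x) (x - x₀) = 0 ↔ cross (gradient (T t) x) (x - x₀) = 0 := by
  rw [cross_gradient_head hχ hx, neg_eq_zero, smul_eq_zero]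
  exact ⟨fun h => h.resolve_left hm, fun h => Or.inr h⟩

/-- **`m + 2 > 0` near the centre**: if `‖v(t,x)‖ ≤ C` and `C·‖x − x₀‖ < 2` then `0 < ⟪v(t,x), x − x₀⟫ + 2` (Cauchy–Schwarz). [folklore] -/
theorem two_add_inner_pos {C : ℝ} {x : E3} (hv : ‖v t x‖ ≤ C) (hx : C * ‖x - x₀‖ < 2) :
    0 < ⟪v t x, x - x₀⟫ + 2 := by
  have h1 : |⟪v t x, x - x₀⟫| ≤ ‖v t x‖ * ‖x - x₀‖ := abs_real_inner_le_norm _ _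
  have h2 : ‖v t x‖ * ‖x - x₀‖ ≤ C * ‖x - x₀‖ := mul_le_mul_of_nonneg_right hv (norm_nonneg _)
  have h3 : -(‖v t x‖ * ‖x - x₀‖) ≤ ⟪v t x, x - x₀⟫ := (abs_le.1 h1).1
  linarith

/-- ★ **Near the centre the head and the potential have the same sphere-critical points** (hence, under the representation, the same as the
vorticity zeros): for `‖v(t,·)‖ ≤ C` and `0 < ‖x − x₀‖`, `C·‖x − x₀‖ < 2`, `∇χ(x) × (x − x₀) = 0 ↔ ∇T(t,x) × (x − x₀) = 0`; on these spheres
`∇_Sχ = −(m + 2)∇_S T` with a POSITIVE weight, so along every vortex line the head is a strictly decreasing function of the potential. [folklore] -/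
theorem sphCrit_head_iff_near_centre {C : ℝ} (hvC : ∀ x, ‖v t x‖ ≤ C)
    (hχ : ∀ x, x ≠ x₀ → gradient χ x =
      (deriv (fun s => T s x) t + ⟪v t x, gradient (T t) x⟫ - Laplacian.laplacian (T t) x) • (x - x₀)
        - (⟪v t x, x - x₀⟫ + 2) • gradient (T t) x)
    {x : E3} (hx : x ≠ x₀) (hr : C * ‖x - x₀‖ < 2) :
    cross (gradient χ x) (x - x₀) = 0 ↔ cross (gradient (T t) x) (x - x₀) = 0 :=
  cross_gradient_head_eq_zero_iff hχ hx (two_add_inner_pos (hvC x) hr).ne'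

end HeadLaw

end Summit.NavierStokesRegularity.NavierStokesRegularity.Theorems.PoloidalLiouville.Antidynamo
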